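import Summits.KontsevichZagierPeriods.KontsevichZagierPeriods.Theses.TorsionLogs
import Summits.KontsevichZagierPeriods.KontsevichZagierPeriods.Theorems.FurushoPentagonSectorToKernelCubeResolutionOfNash
import Summits.KontsevichZagierPeriods.KontsevichZagierPeriods.Theorems.SymplecticScissorsCubeNashNormalForm

/-!
# Route KontsevichZagierPeriods/TorsionLogs — crux `TorsionSectorComplete` (stmt-KontsevichZagierPeriods-14212),
# line `ayoub-cube`, stub `stub_cubeResolution` — PROVED

The first registered stub of the strategist line `ayoub-cube` (Cruxes/TorsionSectorComplete/Lines/ayoub_cube.lean):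
CUBE RESOLUTION INSIDE THE RULES — every integral representation of the H21 calculus is congruent modulo
`KZ.relations` to a `ℤ`-combination of tame cube classes `[[0,1]ⁿ, f]`, `f` real analytic on a neighbourhood of
the closed cube.  The statement is, verbatim, the hub item stmt-KontsevichZagierPeriods-17978
(`HermiteRigidity.CubeResolution`; also stub S1 of `FurushoPentagon.SectorToKernel`, S1b of `ReducedPeriodRing`).

Proof: the cube–Nash normal form `LiftingCriteria.CubeNashNormalForm` (item stmt-3574) is a THEOREM
(`SymplecticScissors.CubeNashNormalForm.cubeNashNormalForm_proof`: chart compiler + embedded cube monomialisation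
by the Jung/Abhyankar induction over `cubeNashNormalForm_of_boundedCubeResolution_three`), and
`FurushoPentagon.SectorToKernel.cubeResolution_of_cubeNashNormalForm` turns it into the cubical resolution over
`ReducedPeriodRing.cubicalSpan`; the item's generating set is that span's by definitional unfolding of
`cubicalSpan` / `cubicalGens` / `unitCube`.

-- adapted from Theorems/FurushoPentagonSectorToKernelCubeResolutionOfNash.lean (`cubeResolution_of_cubeNashNormalForm`)
References: M. Kontsevich, D. Zagier, *Periods* (2001), §1.2; J. Ayoub, *Periods and the conjectures of
Grothendieck and Kontsevich–Zagier*, EMS Newsl. 91 (2014), Def. 9–10, Prop. 11; H. Hironaka, Ann. of Math. 79 (1964).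
-/

namespace Summit.KontsevichZagierPeriods.TorsionLogs.TorsionSectorCompleteStubCubeResolution

/-- **`stub_cubeResolution` (line `ayoub-cube` of crux stmt-KontsevichZagierPeriods-14212) holds**: cube resolution
inside the rules, from the landed cube–Nash normal form. [cite: KontsevichZagier2001, §1.2] [cite: Ayoub2014, Def. 9–10] [folklore] -/
theorem stub_cubeResolution :
    ∀ (N : ℕ) (u : Literature.NumberTheory.Transcendental.KZ.IntegralRep N), ∃ c ∈ AddSubgroup.closure {d : Literature.NumberTheory.Transcendental.KZ.FormalRep | ∃ (n : ℕ) (r : Literature.NumberTheory.Transcendental.KZ.IntegralRep n), r.domain = {x : Fin n → ℝ | ∀ i, 0 ≤ x i ∧ x i ≤ 1} ∧ AnalyticOnNhd ℝ r.integrand {x : Fin n → ℝ | ∀ i, 0 ≤ x i ∧ x i ≤ 1} ∧ d = Literature.NumberTheory.Transcendental.KZ.of r}, Literature.NumberTheory.Transcendental.KZ.of u - c ∈ Literature.NumberTheory.Transcendental.KZ.relations := by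
  intro N u
  obtain ⟨c, hc, h⟩ :=
    Summit.KontsevichZagierPeriods.FurushoPentagon.SectorToKernel.cubeResolution_of_cubeNashNormalForm
      Summit.KontsevichZagierPeriods.SymplecticScissors.CubeNashNormalForm.cubeNashNormalForm_proof N u
  exact ⟨c, hc, h⟩

end Summit.KontsevichZagierPeriods.TorsionLogs.TorsionSectorCompleteStubCubeResolution
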